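import Mathlib.LinearAlgebra.Matrix.Dual
import Mathlib.LinearAlgebra.Dual.Lemmas
import Mathlib.FieldTheory.Finiteness
import Literature.Computability.MetaComplexity.AffineSystemClosure
import Literature.Computability.MetaComplexity.ResLinWidth
import Summits.PneNP.PneNP.Theorems.ReslinSizeFromWidthWidthFromVertexExpansionBridge
import Summits.PneNP.PneNP.Theorems.ReslinMediumCoverManyMediumLinesEdgeFlip

/-!
# PneNP / ReslinMediumCover — the boundary law in COUNTING form (stub BL of crux `ManyMediumLines`,
stmt-PneNP-19698): a linear clause whose critical support has `m ≥ 1` boundary edges has at most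
`2^{3N² - m - 1}` falsifying assignments

Route `PneNP/ReslinMediumCover`, crux `Summit.PneNP.PneNP.Theses.ReslinMediumCover.ManyMediumLines`
(open problem; NOT claimed). Companion of `ReslinMediumCoverManyMediumLinesBoundaryLaw.lean` (rank form
`|∂S| + 1 ≤ linClauseRank C`). The bottleneck-counting skeleton of the crux needs the boundary law as a
bound on the NUMBER OF FALSIFIERS of a line, `|{x : C(pad x) = false}| ≤ 2^{3N² - |∂S| - 1}`, which is
NOT a consequence of the rank form (the number of falsifiers of `C` on the `3N²` slots is
`2^{3N² - rk_eff}` with `rk_eff ≤ linClauseRank C` the rank of the forms RESTRICTED to the slots); it is a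
consequence of the same proof, whose closure bound is in terms of `rk_eff`. This file records it:

* `card_Sol_eq_two_pow` — an affine system over `𝔽₂` with a solution has exactly
  `2^{|V| - dim ⟨L(Ψ)⟩}` solutions (dot-product duality, `Subspace.finrank_add_finrank_dualCoannihilator_eq`);
* `exists_closure_critSupport_card` — the closure `Q₀` of the rank-form file, with the size bound stated
  as `|falsifiers of C| ≤ 2^{3N² - (|Q₀| + 1)}`;
* **`card_falsifiers_le_of_edgeCut_nonempty`** — `∂S ≠ ∅ ⇒ |{x : C(pad x) = false}| ≤ 2^{3N² - (|∂S| + 1)}`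
  (`S = critSupport G c C`, `∂S = edgeCut G S`), and the connected form.

References: as in the rank-form file (Efremenko–Garlík–Itsykson STOC 2024 §3–4; Bhattacharya–Byramji–
Chattopadhyay–Impagliazzo STOC 2026 Lemma 4.5; Jukna 2012 Thm 18.17 — resolution: a clause of critical
support `S` has `≤ 2^{n - |∂S|}` falsifiers).
-/

namespace Summit.PneNP.PneNP.Theorems

-- `Summit.PneNP.PneNP` repeats a path component by design (summit = sub-problem); silence the linter.
set_option linter.dupNamespace false

namespace ResLinBoundaryLaw

open Finset Module Literature.Computability.Complexity Literature.Computability.MetaComplexity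
open Literature.Computability.MetaComplexity.AffSys

/-! ### The number of solutions of an affine system -/

/-- An affine system over `𝔽₂` on a finite variable set `V` that has a solution has exactly
`2^{|V| - dim ⟨L(Ψ)⟩}` solutions (its solution set is a coset of the dot-product orthogonal of the form
span). [folklore; Efremenko–Garlík–Itsykson 2024, §2.1 (rank of a linear system)] -/
theorem card_Sol_eq_two_pow {V : Type*} [Fintype V] [DecidableEq V] (Ψ : AffSys V)
    (hcons : (Sol Ψ).Nonempty) :
    Nat.card (Sol Ψ) = 2 ^ (Fintype.card V - finrank (ZMod 2) (spanS Ψ)) := by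
  classical
  obtain ⟨z₀, hz₀⟩ := hcons
  -- the orthogonal `D` of `⟨L(Ψ)⟩` for the dot product, as a dual coannihilator
  set E : (V → ZMod 2) ≃ₗ[ZMod 2] Module.Dual (ZMod 2) (V → ZMod 2) :=
    dotProductEquiv (ZMod 2) V with hE
  set W : Submodule (ZMod 2) (Module.Dual (ZMod 2) (V → ZMod 2)) :=
    (spanS Ψ).map (E : (V → ZMod 2) →ₗ[ZMod 2] Module.Dual (ZMod 2) (V → ZMod 2)) with hW
  set D : Submodule (ZMod 2) (V → ZMod 2) := W.dualCoannihilator with hD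
  have hmemD : ∀ d, d ∈ D ↔ ∀ w ∈ spanS Ψ, w ⬝ᵥ d = 0 := by
    intro d
    rw [hD, Submodule.mem_dualCoannihilator]
    constructor
    · intro h w hw
      have := h (E w) (Submodule.mem_map_of_mem hw)
      simpa [hE] using this
    · intro h φ hφ
      rw [hW, Submodule.mem_map] at hφ
      obtain ⟨w, hw, rfl⟩ := hφ
      simpa [hE] using h w hw
  -- dimension of `D`
  have hdim : finrank (ZMod 2) D = Fintype.card V - finrank (ZMod 2) (spanS Ψ) := by
    have h1 := Subspace.finrank_add_finrank_dualCoannihilator_eq W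
    rw [Module.finrank_fintype_fun_eq_card] at h1
    have h2 : finrank (ZMod 2) W = finrank (ZMod 2) (spanS Ψ) := by
      rw [hW]
      exact LinearEquiv.finrank_map_eq E (spanS Ψ)
    rw [← hD, h2] at h1
    omega
  -- `Sol Ψ = z₀ + D`
  have hSol : Sol Ψ = (fun d => z₀ + d) '' (D : Set (V → ZMod 2)) := by
    ext z
    constructor
    · intro hz
      refine ⟨z - z₀, ?_, by abel⟩
      rw [SetLike.mem_coe, hmemD]
      -- every form of the span is constant on the solution set
      intro w hw
      have hker : spanS Ψ ≤ LinearMap.ker (E (z - z₀)) := by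
        rw [spanS, Submodule.span_le]
        intro f hf
        rw [Finset.mem_coe, forms, Finset.mem_image] at hf
        obtain ⟨p, hp, rfl⟩ := hf
        rw [SetLike.mem_coe, LinearMap.mem_ker]
        have h1 := hz p hp
        have h2 := hz₀ p hp
        have : p.1 ⬝ᵥ (z - z₀) = 0 := by rw [dotProduct_sub, h1, h2, sub_self]
        simpa [hE, dotProduct_comm] using this
      have := hker hw
      rw [LinearMap.mem_ker] at this
      simpa [hE, dotProduct_comm] using this
    · rintro ⟨d, hd, rfl⟩
      rw [SetLike.mem_coe, hmemD] at hd
      exact add_mem_Sol hz₀ (fun p hp => hd p.1 (mem_spanS_of_mem hp))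
  rw [hSol, Nat.card_congr (Equiv.Set.image _ _ (add_right_injective z₀)).symm]
  have hcardD : Nat.card (D : Set (V → ZMod 2)) = Nat.card D := rfl
  rw [hcardD, Module.natCard_eq_pow_finrank (K := ZMod 2) (V := D), hdim, Nat.card_eq_fintype_card,
    ZMod.card]

/-! ### The closure, with the counting size bound -/

variable {N : ℕ} (G : SimpleGraph (Fin N)) [DecidableRel G.Adj] (c : Fin N → Bool)

/-- The closure of `exists_closure_critSupport` with its size bound in COUNTING form: for every linear
clause `C` there is a set `Q₀` of edges with `Q₀ = ∅` or
`|{x : C(pad x) = false}| ≤ 2^{3N² - (|Q₀| + 1)}`, outside of which the critical support of `C` is closed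
under adjacency. (Same construction: closure lemma on the system `¬C` over the `3N²` slots with one
three-slot block per edge + one edge flip; the number of falsifiers is `2^{3N² - rk}` by
`card_Sol_eq_two_pow`.) -/
theorem exists_closure_critSupport_card (C : LinClause) :
    ∃ Q₀ : Finset (Sym2 (Fin N)), Q₀ ⊆ G.edgeFinset ∧
      (Q₀ = ∅ ∨ Nat.card {x : Fin (3 * N ^ 2) → Bool // C.eval (pad x) = false} ≤
        2 ^ (3 * N ^ 2 - (Q₀.card + 1))) ∧
      ∀ v ∈ critSupport G c C, ∀ v', G.Adj v v' → s(v, v') ∉ Q₀ → v' ∈ critSupport G c C := by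
  classical
  -- the slots, the blocks
  let E : Type := ↥G.edgeFinset
  let b : E → Fin 3 → Fin (3 * N ^ 2) := fun e i => ⟨liftVar e.1 i.1, liftVar_lt e.1 i.2⟩
  have hb : ∀ e e' i i', b e i = b e' i' → e = e' ∧ i = i' := by
    intro e e' i i' h
    have h' : liftVar e.1 i.1 = liftVar e'.1 i'.1 := congrArg Fin.val h
    obtain ⟨h1, h2⟩ := liftVar_inj i.2 i'.2 h'
    exact ⟨Subtype.ext h1, Fin.ext h2⟩
  -- the affine system `¬C` on the slots
  let formF : Finset ℕ → Fin (3 * N ^ 2) → ZMod 2 := fun f v => if (v : ℕ) ∈ f then 1 else 0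
  let rhs : Bool → ZMod 2 := fun bb => if bb = true then 0 else 1
  let enc : LinLit → (Fin (3 * N ^ 2) → ZMod 2) × ZMod 2 := fun l => (formF l.1, rhs l.2)
  let Ψ : AffSys (Fin (3 * N ^ 2)) := C.image enc
  let zvec : (Fin (3 * N ^ 2) → Bool) → Fin (3 * N ^ 2) → ZMod 2 :=
    fun x v => if x v = true then 1 else 0
  have hdec : ∀ bb : Bool, decide ((if bb = true then (1 : ZMod 2) else 0) = 1) = bb := by decide
  -- dictionary: `C` false at `pad x` iff `zvec x` solves `Ψ`
  have hdict : ∀ x : Fin (3 * N ^ 2) → Bool, C.eval (pad x) = false ↔ zvec x ∈ Sol Ψ := by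
    intro x
    rw [LinClause.eval_eq_false_iff, mem_Sol]
    constructor
    · intro h q hq
      have hq' : q ∈ C.image enc := hq
      obtain ⟨l, hl, rfl⟩ := Finset.mem_image.mp hq'
      have := (ResLinRank.linLit_eval_eq_false_iff (pad x) l.1 l.2).mp (h _ hl)
      rw [card_filter_pad_eq_dotProduct x l.1] at this
      exact this
    · intro h l hl
      have hmem : enc l ∈ C.image enc := Finset.mem_image.mpr ⟨l, hl, rfl⟩
      have hq := h (enc l) hmem
      rcases l with ⟨f, bb⟩
      apply (ResLinRank.linLit_eval_eq_false_iff (pad x) f bb).mpr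
      rw [card_filter_pad_eq_dotProduct x f]
      exact hq
  -- counting: the falsifiers of `C` are in bijection with `Sol Ψ`
  have hcount : Nat.card {x : Fin (3 * N ^ 2) → Bool // C.eval (pad x) = false} =
      Nat.card (Sol Ψ) := by
    have hzinj : Function.Injective zvec := by
      intro x x' h
      funext v
      have := congrFun h v
      simp only [zvec] at this
      revert this
      cases x v <;> cases x' v <;> decide
    have himg : Sol Ψ = zvec '' {x | C.eval (pad x) = false} := by
      ext z
      constructor
      · intro hz
        refine ⟨fun v => decide (z v = 1), ?_, ?_⟩
        · show C.eval _ = false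
          rw [hdict]
          have : zvec (fun v => decide (z v = 1)) = z := by
            funext w
            have h2 : ∀ a : ZMod 2, (if decide (a = 1) = true then (1 : ZMod 2) else 0) = a := by
              decide
            exact h2 (z w)
          rw [this]
          exact hz
        · funext w
          have h2 : ∀ a : ZMod 2, (if decide (a = 1) = true then (1 : ZMod 2) else 0) = a := by decide
          exact h2 (z w)
      · rintro ⟨x, hx, rfl⟩
        exact (hdict x).mp hx
    rw [himg, Nat.card_congr (Equiv.Set.image _ _ hzinj).symm]
    rfl
  -- the closure
  obtain ⟨Q₀E, hsize, p, hprod⟩ :=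
    AffSys.exists_closure (by norm_num : 0 < 3) b hb Ψ
  refine ⟨Q₀E.image Subtype.val, ?_, ?_, ?_⟩
  · intro e he
    obtain ⟨e', -, rfl⟩ := Finset.mem_image.mp he
    exact e'.2
  · rcases hsize with h | h
    · left
      rw [h, Finset.image_empty]
    · right
      rw [Finset.card_image_of_injective _ Subtype.val_injective, hcount]
      by_cases hsol : (Sol Ψ).Nonempty
      · rw [card_Sol_eq_two_pow Ψ hsol, Fintype.card_fin]
        exact Nat.pow_le_pow_right (by norm_num) (by omega)
      · rw [Set.not_nonempty_iff_eq_empty] at hsol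
        rw [hsol]
        simp
  -- closedness of the critical support under non-`Q₀` adjacency
  intro v hv v' hadj hnot
  rw [mem_critSupport] at hv ⊢
  obtain ⟨x, hx, hfalse⟩ := hv
  have he₀ : s(v, v') ∈ G.edgeFinset := by
    rw [SimpleGraph.mem_edgeFinset]
    exact hadj
  let e₀ : E := ⟨s(v, v'), he₀⟩
  have he₀Q : e₀ ∉ Q₀E := fun h => hnot (Finset.mem_image.mpr ⟨e₀, h, rfl⟩)
  -- target lifted values: flip `e₀`, keep the rest
  let tv : E → Bool := fun e => if e = e₀ then !edgeVal (pad x) e.1 else edgeVal (pad x) e.1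
  let t : E → Fin 3 → ZMod 2 := fun e _ => if tv e = true then 1 else 0
  have hα : zvec x ∈ Sol Ψ := (hdict x).mp hfalse
  obtain ⟨β, hβ, hagree, hfree⟩ := hprod (zvec x) hα t
  -- back to Booleans
  let x' : Fin (3 * N ^ 2) → Bool := fun v => decide (β v = 1)
  have hzx' : zvec x' = β := by
    funext w
    have h2 : ∀ a : ZMod 2, (if decide (a = 1) = true then (1 : ZMod 2) else 0) = a := by decide
    exact h2 (β w)
  have hfalse' : C.eval (pad x') = false := (hdict x').mpr (by rw [hzx']; exact hβ)
  refine ⟨x', ?_, hfalse'⟩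
  -- the lifted edge values of `x'`
  have hval : ∀ e : E, edgeVal (pad x') e.1 = tv e := by
    intro e
    by_cases heQ : e ∈ Q₀E
    · -- a closure block: same slots as `x`
      have hslot : ∀ (i : ℕ) (hi : i < 3), pad x' (liftVar e.1 i) = pad x (liftVar e.1 i) := by
        intro i hi
        rw [pad_liftVar x' e.1 hi, pad_liftVar x e.1 hi]
        have h1 := hagree (b e ⟨i, hi⟩) (fun e' he' i' h => he' ((hb e' e i' ⟨i, hi⟩ h).1 ▸ heQ))
        show decide (β (b e ⟨i, hi⟩) = 1) = x (b e ⟨i, hi⟩)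
        rw [h1]
        exact hdec (x (b e ⟨i, hi⟩))
      have hne : e ≠ e₀ := fun h => he₀Q (h ▸ heQ)
      have : tv e = edgeVal (pad x) e.1 := by simp [tv, hne]
      rw [this]
      unfold edgeVal
      rw [hslot 0 (by norm_num), hslot 1 (by norm_num), hslot 2 (by norm_num)]
    · -- a free block: two slots carry the target bit
      have hslot : ∀ i : Fin 3, i ≠ p e → x' (b e i) = tv e := by
        intro i hi
        have h1 := hfree e heQ i hi
        show decide (β (b e i) = 1) = tv e
        rw [h1]
        exact hdec (tv e)
      unfold edgeVal
      rw [pad_liftVar x' e.1 (by norm_num : 0 < 3), pad_liftVar x' e.1 (by norm_num : 1 < 3),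
        pad_liftVar x' e.1 (by norm_num : 2 < 3)]
      exact gadgetMaj3_eq_of_two _ _ _ _ (p e) (fun h => hslot 0 (Ne.symm h))
        (fun h => hslot 1 (Ne.symm h)) (fun h => hslot 2 (Ne.symm h))
  -- one edge flip
  refine critAt_of_flip_edge G c hadj hx ?_ ?_
  · have := hval e₀
    simpa [tv] using this
  · intro e he hne
    have heF : e ∈ G.edgeFinset := SimpleGraph.mem_edgeFinset.mpr he
    have := hval ⟨e, heF⟩
    have hne' : (⟨e, heF⟩ : E) ≠ e₀ := fun h => hne (congrArg Subtype.val h)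
    simpa [tv, hne'] using this

/-! ### The boundary law, counting form -/

/-- **Boundary law (counting form).** If the edge boundary `∂S` of the critical support `S` of a linear
clause `C` (with respect to `τ(G, c) ∘ MAJ₃`) is nonempty, then `C` has at most `2^{3N² - (|∂S| + 1)}`
falsifying assignments of the `3N²` slots. (Resolution version: `≤ 2^{n - |∂S|}`, Jukna 2012 Thm 18.17;
one system up the gadget gives one more halving.) -/
theorem card_falsifiers_le_of_edgeCut_nonempty (C : LinClause)
    (hne : (edgeCut G (critSupport G c C)).Nonempty) :
    Nat.card {x : Fin (3 * N ^ 2) → Bool // C.eval (pad x) = false} ≤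
      2 ^ (3 * N ^ 2 - ((edgeCut G (critSupport G c C)).card + 1)) := by
  classical
  obtain ⟨Q₀, hQ₀E, hsize, hclosed⟩ := exists_closure_critSupport_card G c C
  -- `∂S ⊆ Q₀`
  have hsub : edgeCut G (critSupport G c C) ⊆ Q₀ := by
    intro e he
    rw [mem_edgeCut] at he
    obtain ⟨heG, ⟨a, haS, hae⟩, ⟨b', hbS, hbe⟩⟩ := he
    by_contra hQ
    have hab : a ≠ b' := fun h => hbS (h ▸ haS)
    have heq : e = s(a, b') := by
      induction e using Sym2.ind with
      | h p q =>
        rw [Sym2.mem_iff] at hae hbe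
        rcases hae with rfl | rfl <;> rcases hbe with rfl | rfl
        · exact absurd rfl hab
        · rfl
        · exact Sym2.eq_swap
        · exact absurd rfl hab
    subst heq
    have hadj : G.Adj a b' := by rwa [SimpleGraph.mem_edgeSet] at heG
    exact hbS (hclosed a haS b' hadj hQ)
  rcases hsize with h | h
  · subst h
    obtain ⟨e, he⟩ := hne
    exact absurd (hsub he) (Finset.notMem_empty e)
  · refine h.trans (Nat.pow_le_pow_right (by norm_num) ?_)
    have := Finset.card_le_card hsub
    omega

/-- **Boundary law (counting form) for connected graphs.** If `G` is connected and the critical support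
`S` of `C` is neither empty nor everything, then `C` has at most `2^{3N² - (|edgeCut G S| + 1)}`
falsifying assignments. -/
theorem card_falsifiers_le_of_connected (hG : G.Connected) (C : LinClause)
    (hS : (critSupport G c C).Nonempty) (hS' : critSupport G c C ≠ Finset.univ) :
    Nat.card {x : Fin (3 * N ^ 2) → Bool // C.eval (pad x) = false} ≤
      2 ^ (3 * N ^ 2 - ((edgeCut G (critSupport G c C)).card + 1)) := by
  classical
  apply card_falsifiers_le_of_edgeCut_nonempty
  obtain ⟨a, ha⟩ := hS
  obtain ⟨b', hb'⟩ : ∃ b', b' ∉ critSupport G c C := by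
    by_contra h
    push Not at h
    exact hS' (Finset.eq_univ_of_forall h)
  obtain ⟨p⟩ := hG a b'
  obtain ⟨d, -, hd1, hd2⟩ :=
    p.exists_boundary_dart (↑(critSupport G c C) : Set (Fin N)) (by simpa using ha) (by simpa using hb')
  refine ⟨d.edge, ?_⟩
  rw [mem_edgeCut]
  refine ⟨d.edge_mem, ⟨d.fst, by simpa using hd1, ?_⟩, ⟨d.snd, by simpa using hd2, ?_⟩⟩
  · rw [SimpleGraph.Dart.edge]; exact Sym2.mem_mk_left _ _
  · rw [SimpleGraph.Dart.edge]; exact Sym2.mem_mk_right _ _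

end ResLinBoundaryLaw

end Summit.PneNP.PneNP.Theorems
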